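import Literature.AnabelianGeometry.EtaleTheta.Discharge.Sec5ThetaSubquotientProjEmptyOfRigidObject
import Literature.AnabelianGeometry.EtaleTheta.SettingModel
import Mathlib.GroupTheory.SpecificGroups.Dihedral

/-!
# [EtTh] §5 p.327 at the ROOT MODEL: `ThetaSubquotientProj 𝔉` is EMPTY at the R2 carrier over abc-iut-L2-t1's `ThetaSetting.model p` — the model certificate (proof-only)

S. Mochizuki, *The étale theta function and its Frobenioid-theoretic manifestations*, Publ. RIMS **45** (2009), §5 p. 327 (PDF p. 101)
(«these subquotients [`Π^tp_X ↠ (Π^tp_X)^Θ ⊇ l·Δ_Θ`] determine subquotients `Aut_D(D) ↠ Aut^Θ_D(D)`; `(l·Δ_Θ)_D ⊆ Aut^Θ_D(D)`»),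
§1 p. 238 (PDF p. 12) (`Δ_Θ`, `(Π^tp_X)^Θ`).  [cite: MochizukiEtTh2009, §5 p.327 (PDF p.101)]
abc-iut cell, layer L2, seat abc-iut-L2-t9 (gen 5): the «KERNEL, separate file of this row» announced in my
`Discharge/Sec5ThetaSubquotientProjEmptyOfRigidObject.lean` (p456572) — VNEXT census item B1 / GAP-LEDGER G-w4d042g3-1.
PROOF-ONLY (0 `def`, no instance, no notation, no `Prop` fact); nothing landed is edited or restated; `decide` only on closed FINITE data
(permutations of `12`/`4` points, the `8`-element group `D₄`); no `native_decide`.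

WHAT IS PROVED.  abc-iut-L2-t4's frozen record `FrobenioidCyclotomicRigidity.ThetaSubquotientProj 𝔉` (the binder `(P : ThetaSubquotientProj 𝔉)`
of the Prop. 5.5 / Thm. 5.6 / Thm. 5.7 (C) chain) asks for `proj E : pre E →* 𝔉.lDelta E` SURJECTIVE at EVERY object `E`.  p456572 reduced its
emptiness at this lineage's R2 carrier to ONE open self-normalising subgroup `H` of countable index with `J(H) ≠ ⊤`.  Here such an `H` is
PRODUCED at abc-iut-L2-t1's root model `ThetaSetting.model p` (`Π^tp_X := F₂ × G_{ℚ_p}`, discrete; `(Π^tp_X)^Θ := Π^tp_X / toHat⁻¹([[Δ̂,Δ̂],Δ̂]⁻)`):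
* `isEmpty_thetaSubquotientProj_ofSetting_model` — **for every ODD `l` and every §5 datum `𝔉` over `B^temp(Π^tp_X)⁰` with theta-subquotient stub
  `ofSetting (model p) l` (print's `Q`, single underline case, abc-iut-L2-t9/L2-t1 `ThetaSubquotientOfThetaSetting.lean`), `ThetaSubquotientProj 𝔉`
  is EMPTY.**
The witness (found by a GAP search on the compute farm, kit job j259833; RE-VERIFIED here by `decide`, `rootModel_witness_data`): two
permutations `α, β` of `12` points (the free generators acting on `P₀/S`, `P₀ = C₃³ ⋊ D₄ = ⟨a,b⟩ ≤ S₉` of order `216`, `S = Δ(S₃) × A₃`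
self-normalising of order `18`), a `4`-colouring intertwining `α, β` with `r₁`, `s r₁ ∈ D₄` acting on `ℤ/4`, and rigidity witnesses.  `H :=` the stabiliser of a point of this `F₂`-set pulled back to
`Π^tp_X`:  OPEN (discrete), of FINITE index (orbit–stabiliser), SELF-NORMALISING by rigidity (`normalizer_stabilizer_le_of_rigid` — generic:
a stabiliser moving every other point is self-normalising), and `J(H) = (q(H) ∩ L)·[L, q(H)] ≠ ⊤` because `J(H)` fixes the colour of the base
point in the `D₄`-shadow of `(Π^tp_X)^Θ` while the class of `([x₀,x₁],1)^l ∈ l·Δ_Θ` acts by the CENTRAL INVOLUTION `r₂` (odd `l`), which moves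
it.  Two «shadow» lemmas make `(Π^tp_X)^Θ` act on the colours: `hom_eq_one_of_eta_mem_closure₃` (every homomorphism `F₂ → Q`, `Q` finite of
class `≤ 2`, kills the elements whose image in `F̂₂` lies in the closure of `[[F̂₂,F̂₂],F̂₂]` — the pattern of abc-iut-L2-t1's
`heisHom_eq_one_of_eta_mem_closure`, via `exists_continuousMonoidHom_extend`) and `hom_mem_commutator_of_eta_mem_closure₂` (the closure of
`[F̂₂,F̂₂]` lands in `[Q,Q]`, for `D₄`: in the centre, `dihedral4_commutator_le_center`); `eta_mem_closure₃_of_mem_KTheta` /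
`eta_mem_closure₂_of_mem_KEll` read abc-iut-L2-t1's kernels `KTheta`, `KEll` in that form.

READING.  At the root model of record the record has NO inhabitant at the R2 stub `ofSetting (model p) l`, `l` odd: every theorem of
the chain binding `(P : ThetaSubquotientProj 𝔉)` there quantifies over an EMPTY type (vacuous as instantiated, nothing false); the owners'
planned repair (surjectivity at GALOIS objects only — G-w4d042g3-1 plan (a) / VNEXT B1) is load-bearing.  HONEST FRAMING: a statement
about the DEGENERATE root model (everything discrete — «consistency evidence only», as its author writes), not about the tempered
fundamental group of a curve; [EtTh] is a refereed paper and nothing of it is asserted; no side is taken on [IUTchIII] Cor. 3.12.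
-/

noncomputable section

namespace Literature.AnabelianGeometry.EtaleTheta

open scoped commutatorElement Pointwise IsMulCommutative

universe u₁ v₁

/-! ### 1. Rigidity ⇒ self-normalising stabiliser -/

/-- If every point `y ≠ x₀` is MOVED by some element of the stabiliser of `x₀`, the stabiliser of `x₀` is
self-normalising (the half `N_Π(H)/H ↪ Aut(Π/H)` of p.327's `Aut_D(D)`-subquotient bookkeeping, for `H = Stab`).
[cite: MochizukiEtTh2009, §5 p.327 (PDF p.101)] -/
theorem normalizer_stabilizer_le_of_rigid {G X : Type*} [Group G] [MulAction G X] (x₀ : X)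
    (hrig : ∀ y : X, y ≠ x₀ → ∃ h ∈ MulAction.stabilizer G x₀, h • y ≠ y) :
    Subgroup.normalizer (MulAction.stabilizer G x₀ : Set G) ≤ MulAction.stabilizer G x₀ := by
  intro g hg
  rw [MulAction.mem_stabilizer_iff]
  by_contra hne
  obtain ⟨h, hh, hmove⟩ := hrig (g • x₀) hne
  have h1 : g⁻¹ * h * g ∈ MulAction.stabilizer G x₀ := by
    refine (Subgroup.mem_normalizer_iff.1 hg (g⁻¹ * h * g)).2 ?_
    have e : g * (g⁻¹ * h * g) * g⁻¹ = h := by group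
    rw [e]; exact hh
  rw [MulAction.mem_stabilizer_iff, mul_smul, mul_smul, inv_smul_eq_iff] at h1
  exact hmove h1

namespace SettingModel

/-! ### 2. Shadows of finite quotients of `F₂` on the profinite completion; the model's kernels -/

/-- A homomorphism from `F₂` to a FINITE group of nilpotency class `≤ 2` kills every element whose image in `F̂₂` lies in the
closure of `[[F̂₂,F̂₂],F̂₂]` (the model's kernel condition for `Π^tp_X ↠ (Π^tp_X)^Θ`, "induced by `Δ_X ↠ Δ_X/[Δ_X,[Δ_X,Δ_X]]`",
p. 12; the pattern of abc-iut-L2-t1's `heisHom_eq_one_of_eta_mem_closure`). [cite: MochizukiEtTh2009, §1 p.12] -/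
theorem hom_eq_one_of_eta_mem_closure₃ (Q : Type) [Group Q] [Finite Q] (f : F₂ →* Q)
    (hQ : ⁅⁅(⊤ : Subgroup Q), (⊤ : Subgroup Q)⁆, (⊤ : Subgroup Q)⁆ = ⊥) (g : F₂)
    (hg : eta g ∈ (⁅⁅(⊤ : Subgroup F₂hat), (⊤ : Subgroup F₂hat)⁆, (⊤ : Subgroup F₂hat)⁆).topologicalClosure) :
    f g = 1 := by
  letI : TopologicalSpace Q := ⊥
  haveI : DiscreteTopology Q := ⟨rfl⟩
  obtain ⟨F, hF⟩ := exists_continuousMonoidHom_extend F₂ Q f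
  have hker : (⁅⁅(⊤ : Subgroup F₂hat), (⊤ : Subgroup F₂hat)⁆, (⊤ : Subgroup F₂hat)⁆).topologicalClosure
      ≤ F.toMonoidHom.ker := by
    refine Subgroup.topologicalClosure_minimal _ ?_ ?_
    · intro x hx
      rw [MonoidHom.mem_ker]
      have hx' : F.toMonoidHom x ∈ (⁅⁅(⊤ : Subgroup F₂hat), (⊤ : Subgroup F₂hat)⁆, (⊤ : Subgroup F₂hat)⁆).map
          F.toMonoidHom := ⟨x, hx, rfl⟩
      rw [Subgroup.map_commutator, Subgroup.map_commutator] at hx'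
      have hle : ⁅⁅(⊤ : Subgroup F₂hat).map F.toMonoidHom, (⊤ : Subgroup F₂hat).map F.toMonoidHom⁆,
          (⊤ : Subgroup F₂hat).map F.toMonoidHom⁆ ≤ ⁅⁅(⊤ : Subgroup Q), (⊤ : Subgroup Q)⁆, (⊤ : Subgroup Q)⁆ :=
        Subgroup.commutator_mono (Subgroup.commutator_mono le_top le_top) le_top
      have := hle hx'; rwa [hQ, Subgroup.mem_bot] at this
    · have : ((F.toMonoidHom.ker : Subgroup F₂hat) : Set F₂hat) = F ⁻¹' {1} := by
        ext x; simp [MonoidHom.mem_ker]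
      rw [this]; exact (isClosed_discrete _).preimage F.continuous
  have h1 : F (eta g) = 1 := hker hg
  rw [eta_apply, hF] at h1; exact h1

/-- A homomorphism from `F₂` to a FINITE group maps every element whose image in `F̂₂` lies in the closure of `[F̂₂,F̂₂]`
into the commutator subgroup (the model's kernel condition for `Π^tp_X ↠ (Π^tp_X)^ell`, "induced by `Δ_X ↠ Δ_X/[Δ_X,Δ_X]`", p. 12).
[cite: MochizukiEtTh2009, §1 p.12] -/
theorem hom_mem_commutator_of_eta_mem_closure₂ (Q : Type) [Group Q] [Finite Q] (f : F₂ →* Q) (g : F₂)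
    (hg : eta g ∈ (⁅(⊤ : Subgroup F₂hat), (⊤ : Subgroup F₂hat)⁆).topologicalClosure) :
    f g ∈ ⁅(⊤ : Subgroup Q), (⊤ : Subgroup Q)⁆ := by
  letI : TopologicalSpace Q := ⊥
  haveI : DiscreteTopology Q := ⟨rfl⟩
  obtain ⟨F, hF⟩ := exists_continuousMonoidHom_extend F₂ Q f
  have hle : (⁅(⊤ : Subgroup F₂hat), (⊤ : Subgroup F₂hat)⁆).topologicalClosure
      ≤ (⁅(⊤ : Subgroup Q), (⊤ : Subgroup Q)⁆).comap F.toMonoidHom := by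
    refine Subgroup.topologicalClosure_minimal _ ?_ ?_
    · intro x hx
      rw [Subgroup.mem_comap]
      have hx' : F.toMonoidHom x ∈ (⁅(⊤ : Subgroup F₂hat), (⊤ : Subgroup F₂hat)⁆).map F.toMonoidHom := ⟨x, hx, rfl⟩
      rw [Subgroup.map_commutator] at hx'
      exact Subgroup.commutator_mono le_top le_top hx'
    · have : (((⁅(⊤ : Subgroup Q), (⊤ : Subgroup Q)⁆).comap F.toMonoidHom : Subgroup F₂hat) : Set F₂hat) =
          F ⁻¹' ((⁅(⊤ : Subgroup Q), (⊤ : Subgroup Q)⁆ : Subgroup Q) : Set Q) := rfl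
      rw [this]; exact (isClosed_discrete _).preimage F.continuous
  have h1 := hle hg
  rw [Subgroup.mem_comap] at h1
  change F (eta g) ∈ _ at h1
  rw [eta_apply, hF] at h1; exact h1

variable (p : ℕ) [Fact p.Prime]

/-- For `g ∈ KTheta`, the `F̂₂`-shadow of its geometric component lies in the closure of `[[F̂₂,F̂₂],F̂₂]`, and its
arithmetic component is trivial. [cite: MochizukiEtTh2009, §1 p.12] -/
theorem eta_mem_closure₃_of_mem_KTheta {g : PiTp p} (hg : g ∈ KTheta p) :
    eta (Del.val g.1) ∈ (⁅⁅(⊤ : Subgroup F₂hat), (⊤ : Subgroup F₂hat)⁆, (⊤ : Subgroup F₂hat)⁆).topologicalClosure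
      ∧ g.2 = 1 := by
  haveI := deltaHat_normal p
  have hmem : (curve p).toHat g ∈
      (⁅⁅(curve p).DeltaHat, (curve p).DeltaHat⁆, (curve p).DeltaHat⁆).topologicalClosure := hg
  refine ⟨?_, (heisHom_eq_one_and_snd_eq_one_of_mem_KTheta p hg).2⟩
  have hle : (⁅⁅(curve p).DeltaHat, (curve p).DeltaHat⁆, (curve p).DeltaHat⁆ : Subgroup (PiHt p)) ≤
      ⁅⁅(⊤ : Subgroup (PiHt p)), (⊤ : Subgroup (PiHt p))⁆, (⊤ : Subgroup (PiHt p))⁆ :=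
    Subgroup.commutator_mono (Subgroup.commutator_mono le_top le_top) le_top
  have h1 := Subgroup.topologicalClosure_mono hle hmem
  -- project along the continuous first projection
  have hsurj : Function.Surjective (MonoidHom.fst F₂hatT (GamHatT p)) := fun x => ⟨(x, 1), rfl⟩
  have h2 : (MonoidHom.fst F₂hatT (GamHatT p)) ((curve p).toHat g) ∈
      ((⁅⁅(⊤ : Subgroup (PiHt p)), (⊤ : Subgroup (PiHt p))⁆, (⊤ : Subgroup (PiHt p))⁆).map
        (MonoidHom.fst F₂hatT (GamHatT p))).topologicalClosure := by
    have hx' : (curve p).toHat g ∈ closure ((⁅⁅(⊤ : Subgroup (PiHt p)), (⊤ : Subgroup (PiHt p))⁆,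
        (⊤ : Subgroup (PiHt p))⁆ : Subgroup (PiHt p)) : Set (PiHt p)) := by rw [← Subgroup.topologicalClosure_coe]; exact h1
    have := image_closure_subset_closure_image continuous_fst ⟨_, hx', rfl⟩
    have h3 : ((curve p).toHat g).1 ∈ ((Subgroup.topologicalClosure (Subgroup.map (MonoidHom.fst F₂hatT (GamHatT p))
        ⁅⁅(⊤ : Subgroup (PiHt p)), (⊤ : Subgroup (PiHt p))⁆, (⊤ : Subgroup (PiHt p))⁆)) : Set F₂hatT) := by
      rw [Subgroup.topologicalClosure_coe, Subgroup.coe_map]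
      exact this
    exact h3
  rw [Subgroup.map_commutator, Subgroup.map_commutator, Subgroup.map_top_of_surjective _ hsurj] at h2
  exact h2

/-- For `g ∈ KEll`, the `F̂₂`-shadow of its geometric component lies in the closure of `[F̂₂,F̂₂]`, and its arithmetic component
is trivial. [cite: MochizukiEtTh2009, §1 p.12] -/
theorem eta_mem_closure₂_of_mem_KEll {g : PiTp p} (hg : g ∈ KEll p) :
    eta (Del.val g.1) ∈ (⁅(⊤ : Subgroup F₂hat), (⊤ : Subgroup F₂hat)⁆).topologicalClosure ∧ g.2 = 1 := by
  haveI := deltaHat_normal p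
  have hmem : (curve p).toHat g ∈ (⁅(curve p).DeltaHat, (curve p).DeltaHat⁆).topologicalClosure := hg
  constructor
  · have hle : (⁅(curve p).DeltaHat, (curve p).DeltaHat⁆ : Subgroup (PiHt p)) ≤
        ⁅(⊤ : Subgroup (PiHt p)), (⊤ : Subgroup (PiHt p))⁆ := Subgroup.commutator_mono le_top le_top
    have h1 := Subgroup.topologicalClosure_mono hle hmem
    have hsurj : Function.Surjective (MonoidHom.fst F₂hatT (GamHatT p)) := fun x => ⟨(x, 1), rfl⟩
    have h2 : (MonoidHom.fst F₂hatT (GamHatT p)) ((curve p).toHat g) ∈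
        ((⁅(⊤ : Subgroup (PiHt p)), (⊤ : Subgroup (PiHt p))⁆).map
          (MonoidHom.fst F₂hatT (GamHatT p))).topologicalClosure := by
      have hx' : (curve p).toHat g ∈ closure ((⁅(⊤ : Subgroup (PiHt p)), (⊤ : Subgroup (PiHt p))⁆ :
          Subgroup (PiHt p)) : Set (PiHt p)) := by rw [← Subgroup.topologicalClosure_coe]; exact h1
      have := image_closure_subset_closure_image continuous_fst ⟨_, hx', rfl⟩
      have h3 : ((curve p).toHat g).1 ∈ ((Subgroup.topologicalClosure (Subgroup.map (MonoidHom.fst F₂hatT (GamHatT p))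
          ⁅(⊤ : Subgroup (PiHt p)), (⊤ : Subgroup (PiHt p))⁆)) : Set F₂hatT) := by
        rw [Subgroup.topologicalClosure_coe, Subgroup.coe_map]
        exact this
      exact h3
    rw [Subgroup.map_commutator, Subgroup.map_top_of_surjective _ hsurj] at h2
    exact h2
  · have h1 := snd_eq_one_of_mem_deltaHat p (toHat_mem_deltaHat_of_mem_KEll p hg)
    exact etaGam_injective p (by rw [map_one]; exact h1)

/-! ### 3. The dihedral group `D₄`: class two, commutators central -/

/-- Every commutator of `D₄` is central. [folklore] -/
private theorem dihedral4_commutator_le_center :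
    ⁅(⊤ : Subgroup (DihedralGroup 4)), (⊤ : Subgroup (DihedralGroup 4))⁆ ≤ Subgroup.center (DihedralGroup 4) := by
  have key : ∀ g h k : DihedralGroup 4, k * ⁅g, h⁆ = ⁅g, h⁆ * k := by decide
  rw [Subgroup.commutator_le]
  intro g _ h _
  rw [Subgroup.mem_center_iff]
  exact fun k => key g h k

/-- `D₄` has nilpotency class two: `[[D₄,D₄],D₄] = 1`. [folklore] -/
private theorem dihedral4_commutator₃_eq_bot :
    ⁅⁅(⊤ : Subgroup (DihedralGroup 4)), (⊤ : Subgroup (DihedralGroup 4))⁆, (⊤ : Subgroup (DihedralGroup 4))⁆ = ⊥ := by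
  rw [eq_bot_iff]
  calc ⁅⁅(⊤ : Subgroup (DihedralGroup 4)), (⊤ : Subgroup (DihedralGroup 4))⁆, (⊤ : Subgroup (DihedralGroup 4))⁆
      ≤ ⁅Subgroup.center (DihedralGroup 4), (⊤ : Subgroup (DihedralGroup 4))⁆ :=
        Subgroup.commutator_mono dihedral4_commutator_le_center le_rfl
    _ = ⊥ := by
        rw [Subgroup.commutator_eq_bot_iff_le_centralizer]
        exact Subgroup.center_le_centralizer _
    _ ≤ ⊥ := le_rfl


/-! ### 4. The finite witness (GAP search, kit job j259833; every clause re-checked here by `decide`) -/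

/-- **The combinatorial witness.**  Two permutations `α, β` of `12` points (the action of the free generators of `F₂` on the cosets
`P₀/S` of the order-`216` witness group `P₀ = ⟨a,b⟩ ≤ S₉`, `S` self-normalising of order `18`), a `4`-colouring `πq` of the points
(the cosets of `S·γ₃(P₀)`), and the standard action `Φ` of the dihedral group `D₄` on `ℤ/4` (`r_k : i ↦ i − k`, `s r_k : i ↦ k − i`) with:
`πq` intertwines `α` with `r₁` and `β` with `s r₁`; `πq 0 = 0`; the central involution `r₂` MOVES `0`; and RIGIDITY witnesses at the
point `0`: `αβ` fixes `0` and moves `1`, `α²βα` fixes `0` and moves every point `≠ 0, 1`.  The combinatorial content of the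
rigid covering of the root model below.  [cite: MochizukiEtTh2009, §5 p.327 (PDF p.101)] -/
theorem rootModel_witness_data :
    ∃ (α β : Equiv.Perm (Fin 12)) (πq : Fin 12 → ZMod 4) (Φ : DihedralGroup 4 →* Equiv.Perm (ZMod 4)),
      (∀ i, πq (α i) = Φ (DihedralGroup.r 1) (πq i)) ∧ (∀ i, πq (β i) = Φ (DihedralGroup.sr 1) (πq i)) ∧
      πq 0 = 0 ∧ Φ (DihedralGroup.r 2) 0 ≠ 0 ∧
      (α * β) 0 = 0 ∧ (α * β) 1 ≠ 1 ∧
      (α * α * β * α) 0 = 0 ∧ (∀ y : Fin 12, y ≠ 0 → y ≠ 1 → (α * α * β * α) y ≠ y) := by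
  refine ⟨⟨![3, 4, 0, 11, 10, 7, 5, 8, 6, 1, 9, 2], ![2, 9, 11, 0, 1, 6, 8, 5, 7, 10, 4, 3], by decide, by decide⟩,
    ⟨![2, 5, 6, 11, 10, 1, 4, 9, 0, 7, 8, 3], ![8, 5, 0, 11, 6, 1, 2, 9, 10, 7, 4, 3], by decide, by decide⟩,
    ![0, 2, 1, 3, 1, 3, 0, 2, 1, 3, 0, 2],
    { toFun := fun d => match d with
        | DihedralGroup.r k => Equiv.subRight k
        | DihedralGroup.sr k => Equiv.subLeft k
      map_one' := by decide
      map_mul' := by decide }, ?_, ?_, ?_, ?_, ?_, ?_, ?_, ?_⟩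
  all_goals decide

/-! ### 5. The rigid covering of the root model with non-trivial theta subquotient -/

/-- **`ThetaSubquotientProj 𝔉` is EMPTY for every §5 datum `𝔉` over `B^temp(Π^tp_X)⁰` at abc-iut-L2-t1's root model
`ThetaSetting.model p` (`Π^tp_X = F₂ × G_{ℚ_p}`) with the theta-subquotient stub `ofSetting (model p) l` (print's `Q`, single
underline case), for every ODD `l`** — the MODEL CERTIFICATE announced in `Sec5ThetaSubquotientProjEmptyOfRigidObject.lean` (p456572).
The rigid covering: `H ≤ Π^tp_X` := the stabiliser of a point in the `12`-point `F₂`-set of `rootModel_witness_data` (pulled back along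
`Π^tp_X ↠ F₂`) — OPEN (everything is discrete), of FINITE index (orbit–stabiliser), SELF-NORMALISING by rigidity of that `F₂`-set
(`normalizer_stabilizer_le_of_rigid`), and with `J(H) ≠ ⊤`: the class of `([x₀,x₁], 1)^l ∈ l·Δ_Θ` acts on the `4`-colouring through
the central involution `r₂` of `D₄` (moving the colour of the base point) while every element of `J(H) = (q(H) ∩ L)·[L, q(H)]` fixes
it — the kernel of `Π^tp_X ↠ (Π^tp_X)^Θ` dies in every finite class-`2` quotient of `F₂` (`hom_eq_one_of_eta_mem_closure₃`) and `Δ_Θ`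
acts through the centre (`hom_mem_commutator_of_eta_mem_closure₂`).  CONSEQUENCE (VNEXT B1 / GAP G-w4d042g3-1): at the root model of
record abc-iut-L2-t4's frozen record `FrobenioidCyclotomicRigidity.ThetaSubquotientProj` (`proj_surjective` at EVERY object) has NO
inhabitant at the R2 carrier, so there the binder `(P : ThetaSubquotientProj 𝔉)` of the Prop. 5.5 / Thm. 5.6 / Thm. 5.7 (C) chain
quantifies over an empty type; the planned repair (surjectivity at GALOIS objects only, plan (a)) is load-bearing, not cosmetic.
HONEST FRAMING: a statement about the DEGENERATE root model (everything discrete; consistency evidence only, as its author says), not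
about the tempered fundamental group of a curve; nothing of [EtTh] is asserted; no side taken on [IUTchIII] Cor. 3.12.
[cite: MochizukiEtTh2009, §5 p.327 (PDF p.101)] -/
theorem isEmpty_thetaSubquotientProj_ofSetting_model (l : ℕ) (hl : Odd l) {C : Type u₁} [CategoryTheory.Category.{v₁} C]
    (𝔉 : ThetaFrobenioid.{0} C
      (Literature.AlgebraicGeometry.Frobenioids.ConnectedPart (SemiGraphs.BTemp (ThetaSetting.model p).PiTemp)))
    (h𝔉 : 𝔉.toThetaSubquotientStub = ThetaSubquotient.ofSetting (ThetaSetting.model p) l) :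
    IsEmpty (FrobenioidCyclotomicRigidity.ThetaSubquotientProj 𝔉) := by
  classical
  haveI hcommΛ : IsMulCommutative ((ThetaSetting.model p).lDeltaTheta l) :=
    ThetaSetting.lDeltaTheta_isMulCommutative _ l
  obtain ⟨α, β, πq, Φ, hA, hB, hπ0, hΦ2, hab0, hab1, hw0, hw⟩ := rootModel_witness_data
  -- the `F₂`-set, the `D₄`-shadow, and their pull-backs to `Π^tp_X = F₂ × Γ`
  set ρ : F₂ →* Equiv.Perm (Fin 12) := FreeGroup.lift ![α, β] with hρ
  set ψ : F₂ →* DihedralGroup 4 := FreeGroup.lift ![DihedralGroup.r 1, DihedralGroup.sr 1] with hψ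
  set ρP : PiTp p →* Equiv.Perm (Fin 12) := ρ.comp (Del.val.comp (MonoidHom.fst Del (Gam p))) with hρP
  set ψP : PiTp p →* DihedralGroup 4 := ψ.comp (Del.val.comp (MonoidHom.fst Del (Gam p))) with hψP
  have hρ0 : ρ (.of 0) = α := by rw [hρ, FreeGroup.lift_apply_of]; rfl
  have hρ1 : ρ (.of 1) = β := by rw [hρ, FreeGroup.lift_apply_of]; rfl
  have hψ0 : ψ (.of 0) = DihedralGroup.r 1 := by rw [hψ, FreeGroup.lift_apply_of]; rfl
  have hψ1 : ψ (.of 1) = DihedralGroup.sr 1 := by rw [hψ, FreeGroup.lift_apply_of]; rfl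
  have hρP_apply : ∀ g : PiTp p, ρP g = ρ (Del.val g.1) := fun _ => rfl
  have hψP_apply : ∀ g : PiTp p, ψP g = ψ (Del.val g.1) := fun _ => rfl
  -- (E) `πq` is `F₂`-equivariant from the `12`-point set to the `D₄`-shadow
  have hequiv : ∀ (f : F₂) (i : Fin 12), πq (ρ f i) = Φ (ψ f) (πq i) := by
    intro f
    induction f using FreeGroup.induction_on with
    | C1 => intro i; rw [map_one, map_one, Equiv.Perm.one_apply, map_one, Equiv.Perm.one_apply]
    | of x =>
      intro i
      fin_cases x
      · change πq (ρ (.of 0) i) = Φ (ψ (.of 0)) (πq i)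
        rw [hρ0, hψ0]; exact hA i
      · change πq (ρ (.of 1) i) = Φ (ψ (.of 1)) (πq i)
        rw [hρ1, hψ1]; exact hB i
    | inv_of x ih =>
      intro i
      rw [map_inv, map_inv, map_inv, Equiv.Perm.inv_def, Equiv.Perm.inv_def, Equiv.eq_symm_apply]
      have := ih ((ρ (.of x)).symm i)
      rw [Equiv.apply_symm_apply] at this; exact this.symm
    | mul x y ihx ihy =>
      intro i
      rw [map_mul, map_mul, map_mul, Equiv.Perm.mul_apply, Equiv.Perm.mul_apply, ihx, ihy]
  -- (K) the kernel of `Π^tp_X ↠ (Π^tp_X)^Θ` dies in the shadow; descend `ψP` to `(Π^tp_X)^Θ`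
  have hker : KTheta p ≤ ψP.ker := by
    intro k hk
    rw [MonoidHom.mem_ker, hψP_apply]
    exact hom_eq_one_of_eta_mem_closure₃ (DihedralGroup 4) ψ dihedral4_commutator₃_eq_bot _
      (eta_mem_closure₃_of_mem_KTheta p hk).1
  set ψbar : GTheta p →* DihedralGroup 4 := QuotientGroup.lift (KTheta p) ψP hker with hψbar
  have hψbar_mk : ∀ g : PiTp p, ψbar (toThetaM p g) = ψP g := fun g => rfl
  -- (H) the subgroup
  letI instA : MulAction (PiTp p) (Fin 12) := MulAction.compHom (Fin 12) ρP
  have hsmul : ∀ (g : PiTp p) (i : Fin 12), g • i = ρP g i := fun _ _ => rfl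
  refine ThetaSubquotient.isEmpty_thetaSubquotientProj_ofSetting_of_normalizer_le (ThetaSetting.model p) l 𝔉 h𝔉
    (MulAction.stabilizer (PiTp p) (0 : Fin 12)) (isOpen_discrete _)
    (Countable.of_equiv _ (MulAction.orbitEquivQuotientStabilizer (PiTp p) (0 : Fin 12))) ?_ ?_
  · -- self-normalising by rigidity
    refine normalizer_stabilizer_le_of_rigid (0 : Fin 12) fun y hy => ?_
    by_cases hy1 : y = 1
    · subst hy1
      refine ⟨(Del.ofF₂ (.of 0 * .of 1), 1), ?_, ?_⟩
      · rw [MulAction.mem_stabilizer_iff, hsmul, hρP_apply]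
        change ρ (.of 0 * .of 1) 0 = 0; rw [map_mul, hρ0, hρ1]; exact hab0
      · rw [hsmul, hρP_apply]
        change ρ (.of 0 * .of 1) 1 ≠ 1; rw [map_mul, hρ0, hρ1]; exact hab1
    · refine ⟨(Del.ofF₂ (.of 0 * .of 0 * .of 1 * .of 0), 1), ?_, ?_⟩
      · rw [MulAction.mem_stabilizer_iff, hsmul, hρP_apply]
        change ρ (.of 0 * .of 0 * .of 1 * .of 0) 0 = 0; rw [map_mul, map_mul, map_mul, hρ0, hρ1]; exact hw0
      · rw [hsmul, hρP_apply]
        change ρ (.of 0 * .of 0 * .of 1 * .of 0) y ≠ y; rw [map_mul, map_mul, map_mul, hρ0, hρ1]; exact hw y hy hy1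
  · -- `J(H) ≠ ⊤`
    intro htop
    -- the element `c := ([x₀,x₁], 1)` and its class `y ∈ Δ_Θ`
    have hu : ((Del.ofF₂ (.of 0), 1) : PiTp p) ∈ (curve p).DeltaTemp := (mem_deltaTemp_iff p _).2 rfl
    have hv : ((Del.ofF₂ (.of 1), 1) : PiTp p) ∈ (curve p).DeltaTemp := (mem_deltaTemp_iff p _).2 rfl
    have hcKEll : (⁅((Del.ofF₂ (.of 0), 1) : PiTp p), ((Del.ofF₂ (.of 1), 1) : PiTp p)⁆) ∈ KEll p := by
      show (curve p).toHat.toMonoidHom (⁅((Del.ofF₂ (.of 0), 1) : PiTp p), ((Del.ofF₂ (.of 1), 1) : PiTp p)⁆) ∈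
        (⁅(curve p).DeltaHat, (curve p).DeltaHat⁆).topologicalClosure
      rw [map_commutatorElement]
      exact Subgroup.le_topologicalClosure _ (Subgroup.commutator_mem_commutator
        (toHat_mem_deltaHat_of_mem_deltaTemp p hu) (toHat_mem_deltaHat_of_mem_deltaTemp p hv))
    set c : PiTp p := ⁅((Del.ofF₂ (.of 0), 1) : PiTp p), ((Del.ofF₂ (.of 1), 1) : PiTp p)⁆ with hc
    have hyΔ : toThetaM p c ∈ (ThetaSetting.model p).DeltaTheta := by
      change toThetaM p c ∈ (thetaToEllM p).ker
      have : c ∈ ((thetaToEllM p).comp (toThetaM p)).ker := by rw [ker_toEllM]; exact hcKEll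
      simpa only [MonoidHom.mem_ker, MonoidHom.comp_apply] using this
    -- `λ := y^l ∈ l·Δ_Θ`, killed by hypothesis
    have hlam : (⟨toThetaM p c ^ l, toThetaM p c, hyΔ, rfl⟩ : (ThetaSetting.model p).lDeltaTheta l) ∈
        ThetaSubquotient.kill (ThetaSetting.model p).toTheta (ThetaSubquotient.ιTheta (ThetaSetting.model p) l)
          (MulAction.stabilizer (PiTp p) (0 : Fin 12)) := by
      rw [htop]; exact Subgroup.mem_top _
    -- the subgroup of `(Π^tp_X)^Θ` fixing the colour `0` in the shadow contains `J(H)`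
    set Fix : Subgroup (GTheta p) :=
      (MulAction.stabilizer (Equiv.Perm (ZMod 4)) (0 : ZMod 4)).comap (Φ.comp ψbar) with hFix
    have hmemFix : ∀ z : GTheta p, z ∈ Fix ↔ Φ (ψbar z) 0 = 0 := by
      intro z
      rw [hFix, Subgroup.mem_comap, MulAction.mem_stabilizer_iff, MonoidHom.comp_apply, Equiv.Perm.smul_def]
    have hHq : (MulAction.stabilizer (PiTp p) (0 : Fin 12)).map (ThetaSetting.model p).toTheta ≤ Fix := by
      rintro _ ⟨h, hh, rfl⟩
      have hh' : ρ (Del.val h.1) 0 = 0 := hh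
      rw [hmemFix]
      change Φ (ψbar (toThetaM p h)) 0 = 0
      rw [hψbar_mk, hψP_apply, ← hπ0, ← hequiv, hh']
    have hcomm : ⁅(ThetaSubquotient.ιTheta (ThetaSetting.model p) l).range,
        (MulAction.stabilizer (PiTp p) (0 : Fin 12)).map (ThetaSetting.model p).toTheta⁆ ≤ Fix := by
      rw [Subgroup.commutator_le]
      rintro z hz _ ⟨h, hh, rfl⟩
      -- `z ∈ l·Δ_Θ` maps to the centre of `D₄`
      rw [ThetaSetting.range_subtype_lDeltaTheta] at hz
      obtain ⟨y, hy, rfl⟩ := hz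
      obtain ⟨x, rfl⟩ := QuotientGroup.mk'_surjective (KTheta p) y
      have hx : x ∈ KEll p := by
        rw [← ker_toEllM, MonoidHom.mem_ker, MonoidHom.comp_apply]
        exact hy
      have hcen : ψbar (QuotientGroup.mk' (KTheta p) x) ∈ Subgroup.center (DihedralGroup 4) := by
        change ψbar (toThetaM p x) ∈ _
        rw [hψbar_mk, hψP_apply]
        exact dihedral4_commutator_le_center
          (hom_mem_commutator_of_eta_mem_closure₂ (DihedralGroup 4) ψ _ (eta_mem_closure₂_of_mem_KEll p hx).1)
      have hcenl : ψbar (QuotientGroup.mk' (KTheta p) x ^ l) ∈ Subgroup.center (DihedralGroup 4) := by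
        rw [map_pow]; exact Subgroup.pow_mem _ hcen l
      rw [hmemFix, map_commutatorElement]
      have : ⁅ψbar (QuotientGroup.mk' (KTheta p) x ^ l), ψbar ((ThetaSetting.model p).toTheta h)⁆ = 1 := by
        rw [commutatorElement_eq_one_iff_mul_comm]
        exact ((Subgroup.mem_center_iff.1 hcenl) _).symm
      rw [this, map_one, Equiv.Perm.one_apply]
    have hkill_le : ThetaSubquotient.killQ (ThetaSetting.model p).toTheta
        (ThetaSubquotient.ιTheta (ThetaSetting.model p) l) (MulAction.stabilizer (PiTp p) (0 : Fin 12)) ≤ Fix :=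
      sup_le (inf_le_left.trans hHq) hcomm
    -- but `λ` moves the colour `0`
    have hlamFix : toThetaM p c ^ l ∈ Fix := hkill_le hlam
    rw [hmemFix, map_pow, hψbar_mk, hψP_apply] at hlamFix
    have hψc : ψ (Del.val c.1) = DihedralGroup.r 2 := by
      change ψ (Del.val (⁅((Del.ofF₂ (.of 0), 1) : PiTp p), ((Del.ofF₂ (.of 1), 1) : PiTp p)⁆).1) = _
      have e1 : (⁅((Del.ofF₂ (.of 0), 1) : PiTp p), ((Del.ofF₂ (.of 1), 1) : PiTp p)⁆).1 =
          ⁅Del.ofF₂ (.of 0), Del.ofF₂ (.of 1)⁆ := rfl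
      rw [e1, map_commutatorElement, map_commutatorElement, Del.val_ofF₂, Del.val_ofF₂, hψ0, hψ1]
      decide
    rw [hψc, DihedralGroup.r_pow] at hlamFix
    obtain ⟨m, rfl⟩ := hl
    have e2 : (2 * ((2 * m + 1 : ℕ) : ZMod 4) : ZMod 4) = 2 := by
      have h4 : (4 : ZMod 4) = 0 := by decide
      push_cast
      linear_combination (m : ZMod 4) * h4
    rw [e2] at hlamFix
    exact hΦ2 hlamFix

end SettingModel

end Literature.AnabelianGeometry.EtaleTheta

end
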